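import Summits.BirchSwinnertonDyer.BirchSwinnertonDyer.Theorems.PrintCf2RubinValueTwoFrameSeedCharacters
import Summits.BirchSwinnertonDyer.BirchSwinnertonDyer.Theorems.PrintCf2SplitBadTwoQuadraticPart
import Literature.NumberTheory.GaloisRepresentations.GaloisCohomology
import Mathlib.Topology.Instances.ZMod
import HarnessLib

/-!
# The `2`-adic avatars of the seed characters factor through the `ℤ₂²`-tower
# (crux `stmt-BirchSwinnertonDyer-23721` `PrintCf2RubinValueTwo.RubinValueFormulaAtTwo`, line
# `value-transport`, stub B18s `stub_frameSeed_two` — file 3 of the seed supply)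

Cell `bsd-print-cf2`, seat `cruxlead-23721` g3.  Theses-free; `--supports` the crux; no definitions.
For the inverse seeds `ω_χ⁻¹` of file 2 (`ω_χ` the Größencharakter `(α) ↦ σ(α)χ(φ₀ α mod 8)⁻¹ mod 𝔭_v³`,
`χ` odd) Weil's avatar (tree `HeckeCharacter.IsAlgebraic.exists_lAdic`, PROVED) is `ℤ₂ˣ`-valued
(`AvatarRigidity.exists_padicIntUnitsChar_of_isPAdicAvatarOf`) with Frobenius values
`χz(Frob_w) = φ₀(g_w) · χ(φ₀ g_w mod 8)` (§2).  For `χ = χ₄ = χ₈χ₈'` these are `≡ 1 (mod 4)`, so by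
Frobenius density (`absoluteGaloisGroup.frobenius_dense`, Chebotarev PROVED in the tree) `χz ≡ 1 (mod 4)`
everywhere and B11 (`QuadraticPart.factorsThroughPair_of_four_dvd`) puts the avatar through EVERY generator
pair of the `ℤ₂²`-tower (§3).  For `χ = χ₈'` the avatar is NOT principal, but `χz_{χ₈'} = χz_{χ₄} · χ₈(χz_{χ₄}
mod 8)` at Frobenii, hence everywhere (closed equaliser), so it dies wherever `χz_{χ₄}` does (§4) — the
quadratic character `ω_{χ₈'}/ω_{χ₄}` of conductor `𝔭_v³` is the first layer of the `ℤ₂`-extension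
ramified only at `v`.

* §1 `forall_mem_of_frobenius_mem` (closed set ⊇ almost all Frobenii is all; `toZModPow` is continuous — tree).
* §2 `exists_unitsChar_avatar_inv` — the avatar of `ω⁻¹` and its Frobenius values.
* §3 `four_dvd_sub_one_of_frobenius`, `factorsThroughPair_of_unitsChar`.
* §4 `unitsChar_eq_one_of_rel`, `factorsThroughPair_of_rel`.

HONEST FRAMING: plumbing over the tree's Weil avatar, Chebotarev density and B11; closes nothing by
itself; beyond-print theorem: no.  BSD is not proved by any of this.

References: [SerreAbelianLadic1968] Ch. I §2.2–2.3, Ch. II §2.7; [Washington1997] §5.1, Thm. 13.4;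
[deShalit1987] II.4.17 (54).
-/

-- the summit namespace `Summit.BirchSwinnertonDyer.BirchSwinnertonDyer` repeats the problem name by design (D-0017)
set_option linter.dupNamespace false
set_option autoImplicit false

noncomputable section

open scoped Classical

open NumberField IsDedekindDomain Field Filter Literature.NumberTheory.GaloisRepresentations
  Literature.NumberTheory.EllipticCurves

namespace Summit.BirchSwinnertonDyer.BirchSwinnertonDyer.Theorems.PrintCf2.FrameSeed

variable {K : Type} [Field K] [NumberField K]

/-! ## §1 Tools: Frobenius density for closed sets (continuity of `toZModPow` is the tree's
`Literature.NumberTheory.GaloisRepresentations.PadicInt.continuous_toZModPow`) -/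

/-- **Frobenius density for a closed set**: a closed subset of `Γ_K` containing every arithmetic Frobenius
above all but finitely many places is all of `Γ_K` (Chebotarev, PROVED in the tree:
`absoluteGaloisGroup.frobenius_dense`). [cite: SerreAbelianLadic1968, Ch. I §2.2 Cor. 2 (a)] -/
theorem forall_mem_of_frobenius_mem {P : Set (absoluteGaloisGroup K)} (hP : IsClosed P)
    (h : ∀ᶠ v : HeightOneSpectrum (𝓞 K) in cofinite,
      ∀ 𝔓 ∈ v.primesAbove, ∀ Φ : absoluteGaloisGroup K, IsArithFrobAt (𝓞 K) Φ 𝔓 → Φ ∈ P)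
    (σ : absoluteGaloisGroup K) : σ ∈ P := by
  set S : Set (HeightOneSpectrum (𝓞 K)) := {v | ¬ ∀ 𝔓 ∈ v.primesAbove, ∀ Φ : absoluteGaloisGroup K,
    IsArithFrobAt (𝓞 K) Φ 𝔓 → Φ ∈ P} with hS
  have hSf : S.Finite := Filter.eventually_cofinite.1 h
  have hdense := absoluteGaloisGroup.frobenius_dense
    Literature.NumberTheory.Automorphic.chebotarev_artinRep_holds K S hSf
  have hsub : {τ : absoluteGaloisGroup K | ∃ v ∉ S, ∃ 𝔓 ∈ v.primesAbove, IsArithFrobAt (𝓞 K) τ 𝔓} ⊆ P := by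
    rintro τ ⟨v, hv, 𝔓, h𝔓, hτ⟩
    by_contra hc
    exact hv fun h' ↦ hc (h' 𝔓 h𝔓 τ hτ)
  have huniv : Set.univ ⊆ P := by
    rw [← hdense.closure_eq]
    exact hP.closure_subset_iff.mpr hsub
  exact huniv (Set.mem_univ σ)

omit [NumberField K] in
/-- A rank-one framed representation with entry `1` at `σ` is trivial at `σ`. [folklore] -/
theorem framedRep_eq_one_of_entry {A : Type*} [CommRing A] [TopologicalSpace A]
    (r : FramedGaloisRep K A 1) {σ : absoluteGaloisGroup K}
    (h : ((r σ : GL (Fin 1) A) : Matrix (Fin 1) (Fin 1) A) 0 0 = 1) : r σ = 1 :=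
  Matrix.GeneralLinearGroup.ext fun i j ↦ by
    rw [Subsingleton.elim i 0, Subsingleton.elim j 0, h, Units.val_one, Matrix.one_apply_eq]

omit [NumberField K] in
/-- A rank-one framed representation trivial at `σ` has entry `1` there. [folklore] -/
theorem entry_eq_one_of_framedRep_eq_one {A : Type*} [CommRing A] [TopologicalSpace A]
    (r : FramedGaloisRep K A 1) {σ : absoluteGaloisGroup K} (h : r σ = 1) :
    ((r σ : GL (Fin 1) A) : Matrix (Fin 1) (Fin 1) A) 0 0 = 1 := by
  rw [h, Units.val_one, Matrix.one_apply_eq]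

/-- A value `χ(u)` of a `ℤ`-valued multiplicative character at a unit is `±1`. [folklore] -/
theorem mulChar_apply_eq_one_or {R : Type*} [CommMonoid R] (χ : MulChar R ℤ) {x : R} (hx : IsUnit x) :
    χ x = 1 ∨ χ x = -1 := by
  obtain ⟨u, rfl⟩ := hx
  have hu := MulChar.coe_toUnitHom χ u
  rcases Int.units_eq_one_or (χ.toUnitHom u) with h | h
  · left; rw [← hu, h, Units.val_one]
  · right; rw [← hu, h, Units.val_neg, Units.val_one]

/-! ## §2 The `ℤ₂ˣ`-valued avatar of an inverse seed -/

section Avatar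

variable (ι : PadicAlgCl 2 ≃+* ℂ) {e : K →+* ℂ} {v : HeightOneSpectrum (𝓞 K)} {φ₀ : 𝓞 K →+* ℤ_[2]}
  (hφe : ∀ k : 𝓞 K, algebraMap ℚ_[2] (PadicAlgCl 2) ((φ₀ k : ℤ_[2]) : ℚ_[2]) = ι.symm (e (k : K)))
  (hv : ∀ k : 𝓞 K, k ∈ v.asIdeal ↔ (2 : ℤ_[2]) ∣ φ₀ k)
include hφe hv

/-- **The avatar of an inverse seed is `ℤ₂ˣ`-valued with Frobenius values `φ₀(g)·χ(φ₀ g mod 8)`.**  Let `ω`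
be algebraic, unramified at every `w ≠ v`, with `ω(ϖ_w) = e(g_w)·χ(φ₀ g_w mod 8)⁻¹` for global `g_w ∉ 𝔭_v`
(`w ≠ v`), where `φ₀ k = ι⁻¹(e k)` in `ℚ̄₂` and `k ∈ 𝔭_v ↔ 2 ∣ φ₀ k`.  Then Weil's `2`-adic avatar `r` of
`ω⁻¹` has entries `χz(σ) ∈ ℤ₂ˣ` for a continuous `χz : Γ_K →ₜ* ℤ₂ˣ`, and at every arithmetic Frobenius `Φ`
above a place `w ≠ v`, `w ∤ 2`: `χz(Φ) = φ₀(g_w) · χ(φ₀ g_w mod 8)`. [cite: SerreAbelianLadic1968, Ch. II §2.7, Ch. III §2.3]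
[cite: Weil1956, §1] -/
theorem exists_unitsChar_avatar_inv {χ : MulChar (ZMod 8) ℤ} {ω : HeckeCharacter K}
    {g : HeightOneSpectrum (𝓞 K) → 𝓞 K} (hωalg : ω.IsAlgebraic)
    (hωu : ∀ w : HeightOneSpectrum (𝓞 K), w ≠ v → ω.IsUnramifiedAt w)
    (hg : ∀ w : HeightOneSpectrum (𝓞 K), w ≠ v → g w ∉ v.asIdeal)
    (hωf : ∀ w : HeightOneSpectrum (𝓞 K), w ≠ v →
      ω.valueAtUniformizer w = e (g w : K) * (((χ (PadicInt.toZModPow 3 (φ₀ (g w))) : ℤ) : ℂ))⁻¹) :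
    ∃ (r : FramedGaloisRep K (PadicAlgCl 2) 1) (χz : absoluteGaloisGroup K →ₜ* ℤ_[2]ˣ),
      IsPAdicAvatarOf ι ω⁻¹ r ∧
      (∀ σ, (((r σ : GL (Fin 1) (PadicAlgCl 2)) : Matrix (Fin 1) (Fin 1) (PadicAlgCl 2)) 0 0) =
        algebraMap ℚ_[2] (PadicAlgCl 2) (((χz σ : ℤ_[2]ˣ) : ℤ_[2]) : ℚ_[2])) ∧
      ∀ w : HeightOneSpectrum (𝓞 K), w ≠ v → ((2 : ℕ) : 𝓞 K) ∉ w.asIdeal →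
        ∀ 𝔓 ∈ w.primesAbove, ∀ Φ : absoluteGaloisGroup K, IsArithFrobAt (𝓞 K) Φ 𝔓 →
          ((χz Φ : ℤ_[2]ˣ) : ℤ_[2]) = φ₀ (g w) * ((χ (PadicInt.toZModPow 3 (φ₀ (g w))) : ℤ) : ℤ_[2]) := by
  obtain ⟨r, hr⟩ := AvatarRigidity.exists_isPAdicAvatarOf ι hωalg.inv
  -- the values of `ω` at `w ≠ v`, read in `ℚ̄₂`
  have hval : ∀ w : HeightOneSpectrum (𝓞 K), w ≠ v →
      ι.symm (ω.valueAtUniformizer w) =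
        algebraMap ℚ_[2] (PadicAlgCl 2) (((φ₀ (g w) : ℤ_[2]) : ℚ_[2]) *
          ((((χ (PadicInt.toZModPow 3 (φ₀ (g w)))) : ℤ) : ℚ_[2]))⁻¹) := by
    intro w hw
    rw [hωf w hw, map_mul, map_inv₀, map_intCast, ← hφe, map_mul, map_inv₀, map_intCast]
  -- `χ(φ₀ g mod 8) = ±1`, so it is its own inverse
  have hχinv : ∀ w : HeightOneSpectrum (𝓞 K), w ≠ v →
      ((((χ (PadicInt.toZModPow 3 (φ₀ (g w)))) : ℤ) : ℚ_[2]))⁻¹ =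
        (((χ (PadicInt.toZModPow 3 (φ₀ (g w)))) : ℤ) : ℚ_[2]) := by
    intro w hw
    rcases mulChar_apply_eq_one_or χ (isUnit_toZModPow_of_not_mem hv 3 (hg w hw)) with h | h <;>
      simp [h]
  -- `ℚ₂`-rationality of the values of `ω⁻¹`
  have hrange : ∀ᶠ w : HeightOneSpectrum (𝓞 K) in cofinite,
      ι.symm (ω⁻¹.valueAtUniformizer w) ∈ Set.range (algebraMap ℚ_[2] (PadicAlgCl 2)) := by
    refine ((Set.finite_singleton v).eventually_cofinite_notMem).mono fun w hw ↦ ?_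
    rw [Set.mem_singleton_iff] at hw
    rw [HeckeCharacter.valueAtUniformizer_inv', map_inv₀, hval w hw, ← map_inv₀]
    exact ⟨_, rfl⟩
  obtain ⟨χz, hχz⟩ := AvatarRigidity.exists_padicIntUnitsChar_of_isPAdicAvatarOf ι hr hrange
  refine ⟨r, χz, hr, hχz, fun w hw hw2 𝔓 h𝔓 Φ hΦ ↦ ?_⟩
  have hentry := AvatarRigidity.entry_eq_of_isPAdicAvatarOf ι hr hw2 ((hωu w hw).inv') 𝔓 h𝔓 Φ hΦ
  rw [hχz Φ, HeckeCharacter.valueAtUniformizer_inv', map_inv₀, inv_inv, hval w hw, hχinv w hw] at hentry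
  have h1 := (algebraMap ℚ_[2] (PadicAlgCl 2)).injective hentry
  exact PadicInt.ext (by push_cast; exact h1)

end Avatar

/-! ## §3 The principal seed (`χ = χ₄ = χ₈χ₈'`): `χz ≡ 1 (mod 4)` and the avatar factors through every pair -/

section Principal

/-- `u · χ₄(u) ≡ 1 (mod 4)` for every odd `u` (`χ₄` read on `ℤ/8` as `χ₈χ₈'`). [folklore] -/
private theorem cast_mul_chi_eq_one : ∀ u : (ZMod 8)ˣ,
    (ZMod.cast (u : ZMod 8) : ZMod 4) * ((ZMod.χ₈ (u : ZMod 8) * ZMod.χ₈' (u : ZMod 8) : ℤ) : ZMod 4) = 1 := by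
  decide

variable {v : HeightOneSpectrum (𝓞 K)} {φ₀ : 𝓞 K →+* ℤ_[2]}
  (hv : ∀ k : 𝓞 K, k ∈ v.asIdeal ↔ (2 : ℤ_[2]) ∣ φ₀ k)
include hv

/-- **The avatar of the `χ₄`-seed is principal: `χz(σ) ≡ 1 (mod 4)` for all `σ`** — at Frobenii
`χz = t·χ₄(t)` with `t = φ₀(g) ∈ ℤ₂ˣ`, which is `≡ 1 (mod 4)`; the set `{χz ≡ 1 (4)}` is closed; Frobenius
density. [cite: SerreAbelianLadic1968, Ch. I §2.2 Cor. 2 (a)] [cite: Washington1997, §5.1] -/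
theorem four_dvd_sub_one_of_frobenius (χz : absoluteGaloisGroup K →ₜ* ℤ_[2]ˣ)
    {g : HeightOneSpectrum (𝓞 K) → 𝓞 K} (hg : ∀ w : HeightOneSpectrum (𝓞 K), w ≠ v → g w ∉ v.asIdeal)
    (hfrob : ∀ w : HeightOneSpectrum (𝓞 K), w ≠ v → ((2 : ℕ) : 𝓞 K) ∉ w.asIdeal →
      ∀ 𝔓 ∈ w.primesAbove, ∀ Φ : absoluteGaloisGroup K, IsArithFrobAt (𝓞 K) Φ 𝔓 →
        ((χz Φ : ℤ_[2]ˣ) : ℤ_[2]) = φ₀ (g w) *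
          ((ZMod.χ₈ (PadicInt.toZModPow 3 (φ₀ (g w))) * ZMod.χ₈' (PadicInt.toZModPow 3 (φ₀ (g w))) : ℤ) : ℤ_[2]))
    (σ : absoluteGaloisGroup K) : (4 : ℤ_[2]) ∣ ((χz σ : ℤ_[2]ˣ) : ℤ_[2]) - 1 := by
  -- the closed set `{σ | χz σ ≡ 1 (mod 4)}`
  set P : Set (absoluteGaloisGroup K) := {σ | PadicInt.toZModPow 2 ((χz σ : ℤ_[2]ˣ) : ℤ_[2]) = 1} with hP
  have hcont : Continuous fun σ : absoluteGaloisGroup K ↦ PadicInt.toZModPow 2 ((χz σ : ℤ_[2]ˣ) : ℤ_[2]) :=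
    (PadicInt.continuous_toZModPow 2 2).comp (Units.continuous_val.comp χz.continuous)
  have hclosed : IsClosed P := (isClosed_discrete {(1 : ZMod (2 ^ 2))}).preimage hcont
  have h2v : (2 : 𝓞 K) ∈ v.asIdeal := (hv 2).mpr (by rw [map_ofNat])
  -- Frobenii lie in `P`
  have hfr : ∀ᶠ w : HeightOneSpectrum (𝓞 K) in cofinite,
      ∀ 𝔓 ∈ w.primesAbove, ∀ Φ : absoluteGaloisGroup K, IsArithFrobAt (𝓞 K) Φ 𝔓 → Φ ∈ P := by
    refine (AvatarRigidity.eventually_notMem_and_isUnramifiedAt (p := 2) (1 : HeckeCharacter K)).mono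
      fun w hw 𝔓 h𝔓 Φ hΦ ↦ ?_
    have hwv : w ≠ v := by rintro rfl; exact hw.1 (by exact_mod_cast h2v)
    obtain ⟨u, hu⟩ := isUnit_toZModPow_of_not_mem hv 3 (hg w hwv)
    change PadicInt.toZModPow 2 ((χz Φ : ℤ_[2]ˣ) : ℤ_[2]) = 1
    rw [hfrob w hwv hw.1 𝔓 h𝔓 Φ hΦ, map_mul, map_intCast, ← PadicInt.cast_toZModPow 2 3 (by norm_num), ← hu]
    exact_mod_cast cast_mul_chi_eq_one u
  have hmem : σ ∈ P := forall_mem_of_frobenius_mem hclosed hfr σ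
  -- `toZModPow 2 x = 1 ⟹ 4 ∣ x - 1`
  have h0 : PadicInt.toZModPow 2 (((χz σ : ℤ_[2]ˣ) : ℤ_[2]) - 1) = 0 := by
    rw [map_sub, map_one, sub_eq_zero]; exact hmem
  rw [← RingHom.mem_ker, PadicInt.ker_toZModPow, Ideal.mem_span_singleton] at h0
  norm_num at h0
  exact h0

/-- **The `χ₄`-seed avatar factors through EVERY generator pair of the `ℤ₂²`-tower** of an imaginary
quadratic `K` (B11 `QuadraticPart.factorsThroughPair_of_four_dvd`). [cite: deShalit1987, II.4.17 (54)]
[cite: Washington1997, Thm. 13.4] -/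
theorem factorsThroughPair_of_principal (hK : IsImaginaryQuadratic K)
    {κ₁ κ₂ : ZpExtension K 2} {γ₁ γ₂ : absoluteGaloisGroup K} (hpair : ZpExtension.IsTopGeneratorPair κ₁ κ₂ γ₁ γ₂)
    {r : FramedGaloisRep K (PadicAlgCl 2) 1} {χz : absoluteGaloisGroup K →ₜ* ℤ_[2]ˣ}
    (hr : ∀ σ, (((r σ : GL (Fin 1) (PadicAlgCl 2)) : Matrix (Fin 1) (Fin 1) (PadicAlgCl 2)) 0 0) =
      algebraMap ℚ_[2] (PadicAlgCl 2) (((χz σ : ℤ_[2]ˣ) : ℤ_[2]) : ℚ_[2]))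
    {g : HeightOneSpectrum (𝓞 K) → 𝓞 K} (hg : ∀ w : HeightOneSpectrum (𝓞 K), w ≠ v → g w ∉ v.asIdeal)
    (hfrob : ∀ w : HeightOneSpectrum (𝓞 K), w ≠ v → ((2 : ℕ) : 𝓞 K) ∉ w.asIdeal →
      ∀ 𝔓 ∈ w.primesAbove, ∀ Φ : absoluteGaloisGroup K, IsArithFrobAt (𝓞 K) Φ 𝔓 →
        ((χz Φ : ℤ_[2]ˣ) : ℤ_[2]) = φ₀ (g w) *
          ((ZMod.χ₈ (PadicInt.toZModPow 3 (φ₀ (g w))) * ZMod.χ₈' (PadicInt.toZModPow 3 (φ₀ (g w))) : ℤ) : ℤ_[2])) :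
    FactorsThroughPair κ₁ κ₂ r :=
  QuadraticPart.factorsThroughPair_of_four_dvd hK.unitsRank_eq_zero hK.nrComplexPlaces_eq_one hpair χz
    (four_dvd_sub_one_of_frobenius hv χz hg hfrob) fun σ hσ ↦ framedRep_eq_one_of_entry r (by
      rw [hr σ, hσ, Units.val_one, PadicInt.coe_one, map_one])

end Principal

/-! ## §4 The `χ₈'`-seed: its avatar is the `χ₄`-avatar times `χ₈` of it, hence dies with it -/

section Relation

/-- `χ₄(u) · χ₈(u·χ₄(u)) = χ₈'(u)` for every odd `u` (`χ₈(±1) = 1`, `χ₈' = χ₄χ₈`). [folklore] -/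
private theorem chi_rel : ∀ u : (ZMod 8)ˣ,
    (ZMod.χ₈ (u : ZMod 8) * ZMod.χ₈' (u : ZMod 8)) *
      ZMod.χ₈ ((u : ZMod 8) * ((ZMod.χ₈ (u : ZMod 8) * ZMod.χ₈' (u : ZMod 8) : ℤ) : ZMod 8)) =
        ZMod.χ₈' (u : ZMod 8) := by
  decide

variable {v : HeightOneSpectrum (𝓞 K)} {φ₀ : 𝓞 K →+* ℤ_[2]}
  (hv : ∀ k : 𝓞 K, k ∈ v.asIdeal ↔ (2 : ℤ_[2]) ∣ φ₀ k)
include hv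

/-- **`χz_B = χz_A · χ₈(χz_A mod 8)` everywhere** for the avatars `χz_A` of the `χ₄`-seed and `χz_B` of
the `χ₈'`-seed (same Frobenius parameter `t = φ₀ g_w`): both sides are continuous and agree at almost all
Frobenii. Consequently `χz_A(σ) = 1 ⟹ χz_B(σ) = 1`. [cite: SerreAbelianLadic1968, Ch. I §2.2 Cor. 2 (a)] -/
theorem unitsChar_eq_one_of_rel (χzA χzB : absoluteGaloisGroup K →ₜ* ℤ_[2]ˣ)
    {g : HeightOneSpectrum (𝓞 K) → 𝓞 K} (hg : ∀ w : HeightOneSpectrum (𝓞 K), w ≠ v → g w ∉ v.asIdeal)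
    (hA : ∀ w : HeightOneSpectrum (𝓞 K), w ≠ v → ((2 : ℕ) : 𝓞 K) ∉ w.asIdeal →
      ∀ 𝔓 ∈ w.primesAbove, ∀ Φ : absoluteGaloisGroup K, IsArithFrobAt (𝓞 K) Φ 𝔓 →
        ((χzA Φ : ℤ_[2]ˣ) : ℤ_[2]) = φ₀ (g w) *
          ((ZMod.χ₈ (PadicInt.toZModPow 3 (φ₀ (g w))) * ZMod.χ₈' (PadicInt.toZModPow 3 (φ₀ (g w))) : ℤ) : ℤ_[2]))
    (hB : ∀ w : HeightOneSpectrum (𝓞 K), w ≠ v → ((2 : ℕ) : 𝓞 K) ∉ w.asIdeal →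
      ∀ 𝔓 ∈ w.primesAbove, ∀ Φ : absoluteGaloisGroup K, IsArithFrobAt (𝓞 K) Φ 𝔓 →
        ((χzB Φ : ℤ_[2]ˣ) : ℤ_[2]) = φ₀ (g w) * ((ZMod.χ₈' (PadicInt.toZModPow 3 (φ₀ (g w))) : ℤ) : ℤ_[2]))
    {σ : absoluteGaloisGroup K} (hσ : χzA σ = 1) : χzB σ = 1 := by
  -- the closed equaliser
  set F : ℤ_[2] → ℤ_[2] := fun x ↦ x * ((ZMod.χ₈ (PadicInt.toZModPow 3 x) : ℤ) : ℤ_[2]) with hF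
  have hG : Continuous (fun x : ℤ_[2] ↦ ((ZMod.χ₈ (PadicInt.toZModPow 3 x) : ℤ) : ℤ_[2])) := by
    have h3 : Continuous (PadicInt.toZModPow 3 : ℤ_[2] → ZMod (2 ^ 3)) := PadicInt.continuous_toZModPow 2 3
    exact (continuous_of_discreteTopology (α := ZMod (2 ^ 3)) (f := fun c ↦ ((ZMod.χ₈ c : ℤ) : ℤ_[2]))).comp h3
  have hFc : Continuous F := continuous_id.mul hG
  set P : Set (absoluteGaloisGroup K) :=
    {τ | ((χzB τ : ℤ_[2]ˣ) : ℤ_[2]) = F ((χzA τ : ℤ_[2]ˣ) : ℤ_[2])} with hP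
  have hclosed : IsClosed P :=
    isClosed_eq (Units.continuous_val.comp χzB.continuous)
      (hFc.comp (Units.continuous_val.comp χzA.continuous))
  have h2v : (2 : 𝓞 K) ∈ v.asIdeal := (hv 2).mpr (by rw [map_ofNat])
  have hfr : ∀ᶠ w : HeightOneSpectrum (𝓞 K) in cofinite,
      ∀ 𝔓 ∈ w.primesAbove, ∀ Φ : absoluteGaloisGroup K, IsArithFrobAt (𝓞 K) Φ 𝔓 → Φ ∈ P := by
    refine (AvatarRigidity.eventually_notMem_and_isUnramifiedAt (p := 2) (1 : HeckeCharacter K)).mono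
      fun w hw 𝔓 h𝔓 Φ hΦ ↦ ?_
    have hwv : w ≠ v := by rintro rfl; exact hw.1 (by exact_mod_cast h2v)
    obtain ⟨u, hu⟩ := isUnit_toZModPow_of_not_mem hv 3 (hg w hwv)
    change ((χzB Φ : ℤ_[2]ˣ) : ℤ_[2]) = F ((χzA Φ : ℤ_[2]ˣ) : ℤ_[2])
    rw [hB w hwv hw.1 𝔓 h𝔓 Φ hΦ, hF]
    simp only
    rw [hA w hwv hw.1 𝔓 h𝔓 Φ hΦ, map_mul, map_intCast, ← hu, mul_assoc, ← Int.cast_mul, chi_rel u]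
  have hmem : σ ∈ P := forall_mem_of_frobenius_mem hclosed hfr σ
  have hval : ((χzB σ : ℤ_[2]ˣ) : ℤ_[2]) = 1 := by
    have h : ((χzB σ : ℤ_[2]ˣ) : ℤ_[2]) = F ((χzA σ : ℤ_[2]ˣ) : ℤ_[2]) := hmem
    rw [h, hσ, Units.val_one, hF]
    change (1 : ℤ_[2]) * ((ZMod.χ₈ (PadicInt.toZModPow 3 (1 : ℤ_[2])) : ℤ) : ℤ_[2]) = 1
    have h8 : ZMod.χ₈ (1 : ZMod (2 ^ 3)) = 1 := by decide
    rw [map_one, h8, Int.cast_one, mul_one]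
  exact Units.ext (by rw [hval, Units.val_one])

/-- **The `χ₈'`-seed avatar factors through the pair wherever the `χ₄`-seed avatar does.**
[cite: deShalit1987, II.4.17 (54)] -/
theorem factorsThroughPair_of_rel {κ₁ κ₂ : ZpExtension K 2}
    {rA rB : FramedGaloisRep K (PadicAlgCl 2) 1} {χzA χzB : absoluteGaloisGroup K →ₜ* ℤ_[2]ˣ}
    (hrA : ∀ σ, (((rA σ : GL (Fin 1) (PadicAlgCl 2)) : Matrix (Fin 1) (Fin 1) (PadicAlgCl 2)) 0 0) =
      algebraMap ℚ_[2] (PadicAlgCl 2) (((χzA σ : ℤ_[2]ˣ) : ℤ_[2]) : ℚ_[2]))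
    (hrB : ∀ σ, (((rB σ : GL (Fin 1) (PadicAlgCl 2)) : Matrix (Fin 1) (Fin 1) (PadicAlgCl 2)) 0 0) =
      algebraMap ℚ_[2] (PadicAlgCl 2) (((χzB σ : ℤ_[2]ˣ) : ℤ_[2]) : ℚ_[2]))
    {g : HeightOneSpectrum (𝓞 K) → 𝓞 K} (hg : ∀ w : HeightOneSpectrum (𝓞 K), w ≠ v → g w ∉ v.asIdeal)
    (hA : ∀ w : HeightOneSpectrum (𝓞 K), w ≠ v → ((2 : ℕ) : 𝓞 K) ∉ w.asIdeal →
      ∀ 𝔓 ∈ w.primesAbove, ∀ Φ : absoluteGaloisGroup K, IsArithFrobAt (𝓞 K) Φ 𝔓 →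
        ((χzA Φ : ℤ_[2]ˣ) : ℤ_[2]) = φ₀ (g w) *
          ((ZMod.χ₈ (PadicInt.toZModPow 3 (φ₀ (g w))) * ZMod.χ₈' (PadicInt.toZModPow 3 (φ₀ (g w))) : ℤ) : ℤ_[2]))
    (hB : ∀ w : HeightOneSpectrum (𝓞 K), w ≠ v → ((2 : ℕ) : 𝓞 K) ∉ w.asIdeal →
      ∀ 𝔓 ∈ w.primesAbove, ∀ Φ : absoluteGaloisGroup K, IsArithFrobAt (𝓞 K) Φ 𝔓 →
        ((χzB Φ : ℤ_[2]ˣ) : ℤ_[2]) = φ₀ (g w) * ((ZMod.χ₈' (PadicInt.toZModPow 3 (φ₀ (g w))) : ℤ) : ℤ_[2]))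
    (hfA : FactorsThroughPair κ₁ κ₂ rA) : FactorsThroughPair κ₁ κ₂ rB := by
  intro σ h₁ h₂
  have h1 : ((χzA σ : ℤ_[2]ˣ) : ℤ_[2]) = 1 := by
    have h := entry_eq_one_of_framedRep_eq_one rA (hfA σ h₁ h₂)
    rw [hrA σ, ← map_one (algebraMap ℚ_[2] (PadicAlgCl 2))] at h
    exact PadicInt.ext (by rw [PadicInt.coe_one]; exact (algebraMap ℚ_[2] (PadicAlgCl 2)).injective h)
  have hA1 : χzA σ = 1 := Units.ext (by rw [h1, Units.val_one])
  have hB1 : χzB σ = 1 := unitsChar_eq_one_of_rel hv χzA χzB hg hA hB hA1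
  exact framedRep_eq_one_of_entry rB (by rw [hrB σ, hB1, Units.val_one, PadicInt.coe_one, map_one])

end Relation

end Summit.BirchSwinnertonDyer.BirchSwinnertonDyer.Theorems.PrintCf2.FrameSeed

end
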